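import Literature.AlgebraicGeometry.Motives.HodgeStructureEndActionCentralBlocks
import Literature.AlgebraicGeometry.Motives.HodgeStructureEndActionBlockDimension
import HarnessLib

/-!
# Milne 1999 §2 on points: the centralizer `C(H)(K) = Z_{End_K(K ⊗ V)}(E_φ ⊗ K)` decomposes along the blocks of a CENTRAL
# field `ι(F) ⊆ E_φ` — `C(H)(K) ≃ₐ[K] ∏_t End_{E_φ ⊗ K}(V_{K,τₜ})` ("`C(A) ⊗_k k^al = ∏_σ C_σ`"), and for `E_φ = ι(F)`
# (type I) `C(H)(K) ≃ₐ[K] ∏_t End_K(V_{K,τₜ})` ("`C(A) = C₁ × ⋯ × C_t`, `Cᵢ = End_{Fᵢ}(Vᵢ)`")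

[topic AlgebraicGeometry/Motives]

Layer `Literature/AlgebraicGeometry/Motives`, lane `lit-hodgefound` (Track 2 foundations library; seat `lit-hodgefound-p34`,
generation 22, self-proposed row g22-#4). Milne defines `C(A)` as the centralizer of `End⁰(A)` in `End_k(V(A))` (§1 p. 643)
and computes it type by type over `k^al` by splitting along the centre: type I (`E = F`): "`C(A) = C₁ × ⋯ × C_t`,
`Cᵢ = End_{Fᵢ}(Vᵢ) ≈ M_{2g/f}(Fᵢ)`" (p. 648); type IV: "`C(A) ⊗_k k^al = ∏ C_σ` where `C_σ ≈ End_Ē(V̄)`" (p. 651). This file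
is the block decomposition of the centralizer on `K`-points, on the abstract `ℚ`-Hodge structure with a number field `F` acting
through `A : EndAction H F` CENTRALLY in `E_φ` (`hcent`), for a field `K` admitting all `[F:ℚ]` embeddings `τ : S ↪ Hom(F, K)`
— the ALGEBRA companion of the lane's group statements (`Motives/HodgeStructureLefschetzGroupEigenspaceSplitting` §5 for
`S(H)(K)`, type I; `Motives/HodgeStructureLefschetzGroupCentralFieldSplitting` for type IV), on top of FILE
`Motives/HodgeStructureEndActionCentralBlocks` (the restricted operators `a_K|V_{K,χ} = EndAction.blockOp`) and the block
sums `EndAction.eigenBlockSum` of `…EigenspaceSplitting`. The `K`-algebra `C(H)(K)` is Mathlib's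
`Subalgebra.centralizer K ((·).baseChange K '' E_φ)`; that its underlying `K`-space is `C(H) ⊗ K` (the `K`-span of the base
changes of the rational centralizer) is the tree's `RingTheory/SimpleModule/CommutantDeligneCMCriterion.span_baseChange_centralizer_eq`
(not re-proved here). Definitions WITH BODIES + theorems, no named fact (net debt `0`).

## The source, verbatim

J. S. Milne, *Lefschetz classes on abelian varieties*, Duke Math. J. **96** (1999) 639–675 [Milne1999LefschetzClasses]
(held `paper:doi-10-1215-s0012-7094-99-09620-5`; Duke page = folio + 638):
* (§1 p. 643 L1–L3) "For an abelian variety `A` over `Ω`, we define `C(A)` to be the centralizer of `End⁰(A)` in `End_k(V(A))`".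
* (§2 p. 646 L43–L52) "`F ⊗_ℚ k = F₁ × ⋯ × F_t` […] `1 = e₁ + ⋯ + e_t` […] any `k`-linear map `α : V(A) → V(A)` commuting
  with the action of `F` decomposes into `α = α₁ ⊕ ⋯ ⊕ α_t`".
* (type I, p. 648 L48–L52) "Here `φᵢ` is a nondegenerate skew-symmetric form on the `Fᵢ`-vector space `Vᵢ`. Therefore,
  `C(A) = C₁ × ⋯ × C_t`, `Cᵢ = End_{Fᵢ}(Vᵢ) ≈ M_{2g/f}(Fᵢ)` and the involution sends an element of `Cᵢ` to its adjoint with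
  respect to `φᵢ`."
* (type IV, p. 651 L64–L70) "Consequently, `C(A) ⊗_k k^al = ∏ C_σ`, where `C_σ ≈ End_Ē(V̄) ≈ M_{g/df}(k^al) × M_{g/df}(k^al)`."

DICTIONARY. `K ⊗ V = ⊕ₜ V_{K,τₜ}` along `ι(F) ⊗ K` (`EndAction.eigenspaceBaseChange`; here ALL `[F:ℚ]` blocks, no pairing and
no polarization); an element of `C(H)(K)` commutes with `ι(F)_K ⊆ E_φ ⊗ K`, so it is block diagonal (`α = ⊕ αₜ`), and its block
`αₜ` commutes with the restricted operators `a_K|V_{K,τₜ}` — it lies in Milne's `C_σ`, here `EndAction.blockCommutant` (the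
commutant of `E_φ|V_{K,τₜ}` in `End_K(V_{K,τₜ})`); conversely a family of such blocks sums to an element of `C(H)(K)` because
every `a_K` is itself block diagonal with blocks `a_K|V_{K,τₜ}` (centrality of `ι(F)`).

## What is PROVED

* §1 DEF **`EndAction.blockCommutant K hcent χ`** (`C_χ = End_{E_φ ⊗ K}(V_{K,χ})` as a `K`-subalgebra of `End_K(V_{K,χ})`),
  `EndAction.mem_blockCommutant_iff`, `EndAction.restrict_mem_blockCommutant` (blocks of `c ∈ C(H)(K)`),
  `EndAction.eigenBlockSum_mem_centralizer` (block sums of commuting blocks lie in `C(H)(K)`).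
* §2 DEF **`EndAction.centralizerBaseChangeAlgEquivBlocks : C(H)(K) ≃ₐ[K] ∏ₜ C_{τₜ}`** ("`C(A) ⊗_k k^al = ∏_σ C_σ`"; it IS
  restriction: `coe_centralizerBaseChangeAlgEquivBlocks_apply`).
* §3 type I: `EndAction.blockCommutant_eq_top_of_endAlg_eq_range` (`E_φ = ι(F)` ⟹ `C_χ = End_K(V_{K,χ})`) and DEF
  **`EndAction.centralizerBaseChangeAlgEquivBlockEnds : C(H)(K) ≃ₐ[K] ∏ₜ End_K(V_{K,τₜ})`** ("`Cᵢ = End_{Fᵢ}(Vᵢ)`"), with the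
  count `EndAction.finrank_blockEnd` (`dim_K End_K(V_{K,τₜ}) = (dim_ℚ V/[F:ℚ])²`, "`≈ M_{2g/f}`").

NOT here (honest): the Morita step `C_σ ≈ End_Ē(V̄) ≈ M_{g/df} × M_{g/df}` for `d > 1` (it needs a splitting of `E_φ ⊗_{F,σ} K`;
`LinearAlgebra/Matrix/MatrixAlgebraModuleCorner.centralizerCornerAlgEquiv` BY NAME, assembled in
`Motives/HodgeStructureLefschetzGroupCentralFieldSplitting`); the involution on `C(A)` (adjoint w.r.t. `φᵢ`); the rational
structure `C(A) = ∏ᵢ Cᵢ` over a non-split `k` (fields `Fᵢ ≠ k`). HC is NOT proved; nothing here claims a case of the Hodge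
conjecture.

## References

* [Milne1999LefschetzClasses] J. S. Milne, *Lefschetz classes on abelian varieties*, Duke Math. J. 96 (1999) 639–675 — §1
  p. 643 (definition of `C(A)`), §2 pp. 646, 648 (type I), 651 (type IV).
* [Deligne1982HodgeCycles] P. Deligne, *Hodge cycles on abelian varieties*, LNM 900 (1982) — §4 (the decomposition
  `H¹_B ⊗ ℂ = ⊕_σ H¹_{B,σ}` along the action of a field).
-/

noncomputable section

open scoped TensorProduct
open Function Module

namespace Literature.AlgebraicGeometry.Motives

namespace HodgeStructure

universe u uK

variable {V : Type u} [AddCommGroup V] [Module ℚ V] {n : ℤ} {H : HodgeStructure V n}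
variable {F : Type*} [Field F] [NumberField F]
variable (K : Type uK) [Field K] [Algebra ℚ K] (A : EndAction H F) {S : Type*} (τ : S → (F →ₐ[ℚ] K))

/-! ## §1 The block commutants `C_χ = End_{E_φ ⊗ K}(V_{K,χ})` and the blocks of an element of `C(H)(K)` -/

/-- **`C_χ = End_{E_φ ⊗ K}(V_{K,χ})`**: the `K`-linear endomorphisms of the block `V_{K,χ}` commuting with every restricted
operator `a_K|V_{K,χ}`, `a ∈ E_φ` (Milne's `C_σ`, resp. `Cᵢ` for type I), as a `K`-subalgebra of `End_K(V_{K,χ})`.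
[cite: Milne1999LefschetzClasses, §2 p. 651 L64–L70 ("C(A) ⊗_k k^al = ∏ C_σ") and p. 648 L48–L52 ("C(A) = C₁ × ⋯ × C_t")] -/
def EndAction.blockCommutant (hcent : ∀ a ∈ H.endAlg, ∀ f : F, a * A.ι f = A.ι f * a) (χ : F →ₐ[ℚ] K) :
    Subalgebra K (A.BlockEnd K χ) :=
  Subalgebra.centralizer K (Set.range (A.blockOp K hcent χ))

/-- Membership in `C_χ`: commute with every `a_K|V_{K,χ}`. [cite: Milne1999LefschetzClasses, §2 p. 651 L64–L70] -/
theorem EndAction.mem_blockCommutant_iff (hcent : ∀ a ∈ H.endAlg, ∀ f : F, a * A.ι f = A.ι f * a) (χ : F →ₐ[ℚ] K)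
    (c : A.BlockEnd K χ) :
    c ∈ A.blockCommutant K hcent χ ↔ ∀ a : H.endAlg, A.blockOp K hcent χ a * c = c * A.blockOp K hcent χ a := by
  rw [EndAction.blockCommutant, Subalgebra.mem_centralizer_iff]
  exact ⟨fun h a => h _ ⟨a, rfl⟩, fun h _ ⟨a, ha⟩ => ha ▸ h a⟩

/-- An element of `C(H)(K) = Z((E_φ)_K)` commutes with every `a_K`, `a ∈ E_φ`. [cite: Milne1999LefschetzClasses, §1 p. 643 L1–L3] -/
theorem baseChange_mul_eq_of_mem_centralizer {c : Module.End K (K ⊗[ℚ] V)}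
    (hc : c ∈ Subalgebra.centralizer K ((fun a : Module.End ℚ V => a.baseChange K) '' (H.endAlg : Set (Module.End ℚ V))))
    {a : Module.End ℚ V} (ha : a ∈ H.endAlg) : a.baseChange K * c = c * a.baseChange K :=
  (Subalgebra.mem_centralizer_iff K).1 hc _ ⟨a, ha, rfl⟩

/-- An element of `C(H)(K)` preserves every block `V_{K,χ}` (it commutes with `ι(F)_K ⊆ E_φ ⊗ K`).
[cite: Milne1999LefschetzClasses, §2 p. 646 L50–L52 ("any k-linear map α commuting with the action of F decomposes into α = α₁ ⊕ ⋯ ⊕ α_t")] -/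
theorem EndAction.apply_mem_eigenspaceBaseChange_of_mem_centralizer {c : Module.End K (K ⊗[ℚ] V)}
    (hc : c ∈ Subalgebra.centralizer K ((fun a : Module.End ℚ V => a.baseChange K) '' (H.endAlg : Set (Module.End ℚ V))))
    {χ : F →ₐ[ℚ] K} {x : K ⊗[ℚ] V} (hx : x ∈ A.eigenspaceBaseChange K χ) : c x ∈ A.eigenspaceBaseChange K χ :=
  A.apply_mem_eigenspaceBaseChange_of_comm K (γ := c)
    (fun f y => by
      rw [← Module.End.mul_apply, ← baseChange_mul_eq_of_mem_centralizer K hc (A.map_F_le f), Module.End.mul_apply]) hx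

/-- **The block `c|V_{K,χ}` of `c ∈ C(H)(K)` lies in `C_χ`.** [cite: Milne1999LefschetzClasses, §2 p. 651 L64–L70] -/
theorem EndAction.restrict_mem_blockCommutant (hcent : ∀ a ∈ H.endAlg, ∀ f : F, a * A.ι f = A.ι f * a)
    {c : Module.End K (K ⊗[ℚ] V)}
    (hc : c ∈ Subalgebra.centralizer K ((fun a : Module.End ℚ V => a.baseChange K) '' (H.endAlg : Set (Module.End ℚ V))))
    (χ : F →ₐ[ℚ] K) :
    (c.restrict fun _ hx => A.apply_mem_eigenspaceBaseChange_of_mem_centralizer K hc (χ := χ) hx : A.BlockEnd K χ) ∈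
      A.blockCommutant K hcent χ := by
  rw [A.mem_blockCommutant_iff K hcent]
  intro a
  refine LinearMap.ext fun x => Subtype.ext ?_
  change (a : Module.End ℚ V).baseChange K (c (x : K ⊗[ℚ] V)) = c ((a : Module.End ℚ V).baseChange K (x : K ⊗[ℚ] V))
  rw [← Module.End.mul_apply, baseChange_mul_eq_of_mem_centralizer K hc a.2, Module.End.mul_apply]

section Blocks

variable [Fintype S] (hτ : Injective τ) (hcard : Fintype.card S = finrank ℚ F)
  (hcent : ∀ a ∈ H.endAlg, ∀ f : F, a * A.ι f = A.ι f * a)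

include hτ hcard in
/-- **A block sum of commuting blocks lies in `C(H)(K)`**: if `gₜ ∈ C_{τₜ}` for every `t`, then `⊕ₜ gₜ` commutes with every
`a_K`, `a ∈ E_φ` (on `V_{K,τₜ}` both sides are `gₜ (a_K|V_{K,τₜ})`, `a_K` being block diagonal by centrality of `ι(F)`).
[cite: Milne1999LefschetzClasses, §2 p. 651 L64–L70 and p. 646 L50–L52] -/
theorem EndAction.eigenBlockSum_mem_centralizer (g : ∀ t : S, A.blockCommutant K hcent (τ t)) :
    A.eigenBlockSum K τ (fun t => ((g t : A.BlockEnd K (τ t)) : _ →ₗ[K] _)) ∈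
      Subalgebra.centralizer K ((fun a : Module.End ℚ V => a.baseChange K) '' (H.endAlg : Set (Module.End ℚ V))) := by
  rw [Subalgebra.mem_centralizer_iff]
  rintro _ ⟨a, ha, rfl⟩
  refine A.linearMap_eq_of_forall_apply_mem_eq K τ hτ hcard fun t x hx => ?_
  have hax : a.baseChange K x ∈ A.eigenspaceBaseChange K (τ t) :=
    A.baseChange_apply_mem_eigenspaceBaseChange_of_central K hcent ha hx
  rw [Module.End.mul_apply, Module.End.mul_apply, A.eigenBlockSum_apply_of_mem K τ hτ hcard _ hax,
    A.eigenBlockSum_apply_of_mem K τ hτ hcard _ hx]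
  have h := (A.mem_blockCommutant_iff K hcent (τ t) _).1 (g t).2 ⟨a, ha⟩
  have hx' := LinearMap.congr_fun h ⟨x, hx⟩
  rw [Module.End.mul_apply, Module.End.mul_apply] at hx'
  have hval := congr_arg Subtype.val hx'
  rw [EndAction.coe_blockOp_apply] at hval
  -- `hval : a_K ((g t) ⟨x,hx⟩) = (g t) (a_K|V x)`
  rw [hval]
  rfl

/-! ## §2 `C(H)(K) ≃ₐ[K] ∏ₜ C_{τₜ}` ("`C(A) ⊗_k k^al = ∏_σ C_σ`") -/

include hτ hcard in
/-- **Milne's "`C(A) ⊗_k k^al = ∏_σ C_σ`" on `K`-points: `C(H)(K) = Z_{End_K(K ⊗ V)}(E_φ ⊗ K) ≃ₐ[K] ∏ₜ End_{E_φ ⊗ K}(V_{K,τₜ})`,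
`c ↦ (c|V_{K,τₜ})ₜ`**, for `ι(F)` central in `E_φ` and `K` admitting all `[F:ℚ]` embeddings `τₜ` (inverse: the block sum
`⊕ₜ gₜ`). [cite: Milne1999LefschetzClasses, §2 p. 651 L64–L70 ("C(A) ⊗_k k^al = ∏ C_σ where C_σ ≈ End_Ē(V̄)") and p. 646 L50–L52] -/
def EndAction.centralizerBaseChangeAlgEquivBlocks :
    Subalgebra.centralizer K ((fun a : Module.End ℚ V => a.baseChange K) '' (H.endAlg : Set (Module.End ℚ V))) ≃ₐ[K]
      ∀ t : S, A.blockCommutant K hcent (τ t) where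
  toFun c := fun t => ⟨_, A.restrict_mem_blockCommutant K hcent c.2 (τ t)⟩
  invFun g := ⟨A.eigenBlockSum K τ fun t => ((g t : A.BlockEnd K (τ t)) : _ →ₗ[K] _),
    A.eigenBlockSum_mem_centralizer K τ hτ hcard hcent g⟩
  left_inv c := Subtype.ext
    (A.eq_eigenBlockSum_of_forall_apply_mem K τ hτ hcard
      (fun t _ hx => A.apply_mem_eigenspaceBaseChange_of_mem_centralizer K c.2 hx)).symm
  right_inv g := funext fun t => Subtype.ext (LinearMap.ext fun x => Subtype.ext (by
    change A.eigenBlockSum K τ (fun t => ((g t : A.BlockEnd K (τ t)) : _ →ₗ[K] _)) (x : K ⊗[ℚ] V) = _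
    rw [A.eigenBlockSum_apply_of_mem K τ hτ hcard _ x.2]))
  map_mul' c d := funext fun t => Subtype.ext (LinearMap.ext fun x => Subtype.ext rfl)
  map_add' c d := funext fun t => Subtype.ext (LinearMap.ext fun x => Subtype.ext rfl)
  commutes' k := funext fun t => Subtype.ext (LinearMap.ext fun x => Subtype.ext (by
    change ((algebraMap K (Module.End K (K ⊗[ℚ] V)) k) (x : K ⊗[ℚ] V)) = ((algebraMap K (A.BlockEnd K (τ t)) k x : _) : K ⊗[ℚ] V)
    rw [Module.algebraMap_end_apply, Module.algebraMap_end_apply, Submodule.coe_smul]))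

include hτ hcard in
/-- The isomorphism IS restriction: `((equiv c) t) x = c x` for `x ∈ V_{K,τₜ}`. [cite: Milne1999LefschetzClasses, §2 p. 651 L64–L70] -/
theorem EndAction.coe_centralizerBaseChangeAlgEquivBlocks_apply
    (c : Subalgebra.centralizer K ((fun a : Module.End ℚ V => a.baseChange K) '' (H.endAlg : Set (Module.End ℚ V))))
    (t : S) (x : A.eigenspaceBaseChange K (τ t)) :
    ((((A.centralizerBaseChangeAlgEquivBlocks K τ hτ hcard hcent c t : A.blockCommutant K hcent (τ t)) :
        A.BlockEnd K (τ t)) x : A.eigenspaceBaseChange K (τ t)) : K ⊗[ℚ] V) = (c : Module.End K (K ⊗[ℚ] V)) x :=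
  rfl

/-! ## §3 Type I (`E_φ = ι(F)`): `C_χ = End_K(V_{K,χ})`, so `C(H)(K) ≃ₐ[K] ∏ₜ End_K(V_{K,τₜ})` ("`Cᵢ = End_{Fᵢ}(Vᵢ) ≈ M_{2g/f}(Fᵢ)`") -/

omit [Fintype S] in
/-- For `E_φ = ι(F)` every restricted operator is a scalar (`ι(f)_K|V_{K,χ} = χ(f)`), so **`C_χ = End_K(V_{K,χ})`**.
[cite: Milne1999LefschetzClasses, §2 p. 648 L48–L52 ("Cᵢ = End_{Fᵢ}(Vᵢ)")] -/
theorem EndAction.blockCommutant_eq_top_of_endAlg_eq_range (hE : H.endAlg = A.ι.range) (χ : F →ₐ[ℚ] K) :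
    A.blockCommutant K hcent χ = ⊤ := by
  refine eq_top_iff.2 fun c _ => (A.mem_blockCommutant_iff K hcent χ c).2 fun a => ?_
  obtain ⟨f, hf⟩ : (a : Module.End ℚ V) ∈ A.ι.range := hE ▸ a.2
  have hscal : A.blockOp K hcent χ a = algebraMap K (A.BlockEnd K χ) (χ f) := by
    refine LinearMap.ext fun x => Subtype.ext ?_
    rw [EndAction.coe_blockOp_apply, Module.algebraMap_end_apply, Submodule.coe_smul, ← hf]
    exact A.baseChange_ι_apply_of_mem_eigenspaceBaseChange K x.2 f
  rw [hscal]
  exact Algebra.commutes _ _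

include hτ hcard in
/-- **Type I on `K`-points: `C(H)(K) ≃ₐ[K] ∏ₜ End_K(V_{K,τₜ})`** for `E_φ = ι(F)` ("`C(A) = C₁ × ⋯ × C_t`, `Cᵢ = End_{Fᵢ}(Vᵢ)`",
over a field `K` splitting `F`). [cite: Milne1999LefschetzClasses, §2 p. 648 L48–L52] -/
def EndAction.centralizerBaseChangeAlgEquivBlockEnds (hE : H.endAlg = A.ι.range) :
    Subalgebra.centralizer K ((fun a : Module.End ℚ V => a.baseChange K) '' (H.endAlg : Set (Module.End ℚ V))) ≃ₐ[K]
      ∀ t : S, A.BlockEnd K (τ t) :=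
  (A.centralizerBaseChangeAlgEquivBlocks K τ hτ hcard hcent).trans
    (AlgEquiv.piCongrRight fun t =>
      (Subalgebra.equivOfEq _ _ (A.blockCommutant_eq_top_of_endAlg_eq_range K hcent hE (τ t))).trans Subalgebra.topEquiv)

include hτ hcard in
/-- `((equiv c) t) x = c x` (type I version). [cite: Milne1999LefschetzClasses, §2 p. 648 L48–L52] -/
theorem EndAction.centralizerBaseChangeAlgEquivBlockEnds_apply_coe (hE : H.endAlg = A.ι.range)
    (c : Subalgebra.centralizer K ((fun a : Module.End ℚ V => a.baseChange K) '' (H.endAlg : Set (Module.End ℚ V))))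
    (t : S) (x : A.eigenspaceBaseChange K (τ t)) :
    ((A.centralizerBaseChangeAlgEquivBlockEnds K τ hτ hcard hcent hE c t x : A.eigenspaceBaseChange K (τ t)) : K ⊗[ℚ] V) =
      (c : Module.End K (K ⊗[ℚ] V)) x :=
  rfl

variable [Module.Finite ℚ V]

include hτ hcard in
/-- **`dim_K End_K(V_{K,τₜ}) = (dim_ℚ V / [F:ℚ])²`** — Milne's "`Cᵢ ≈ M_{2g/f}(Fᵢ)`" as a count (`2g = dim_ℚ V`, `f = [F:ℚ]`).
[cite: Milne1999LefschetzClasses, §2 p. 648 L50 ("Cᵢ = End_{Fᵢ}(Vᵢ) ≈ M_{2g/f}(Fᵢ)") and Prop. 2.1] -/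
theorem EndAction.finrank_blockEnd (t : S) :
    finrank K (A.BlockEnd K (τ t)) = (finrank ℚ V / finrank ℚ F) ^ 2 := by
  haveI := Module.Free.of_divisionRing K (A.eigenspaceBaseChange K (τ t))
  rw [Module.finrank_linearMap, A.finrank_eigenspaceBaseChange_eq_div K τ hτ hcard t, sq]

end Blocks

end HodgeStructure

end Literature.AlgebraicGeometry.Motives
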